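import Summits.QuantumFields.BalabanUV.T4Continuum.Support.VariationalColourUpperBound
import Summits.QuantumFields.BalabanUV.T4Continuum.Support.VariationalColourFederbush

/-!
# T⁴ programme, spine node NE2 (U1a), lane P2 — SUPPLIER LEAF V-COL-UB, sequel: the block form of the in-block hypothesis, the lattice-units `∃`-form,
# and two DATA CLASSES that discharge the transport binders (isometric site transports = unitary colour data; unit phases = the scalar leaf)

NE2 formalisation swarm `b2b-balaban-t4-ne2-formalise-*`, leaf 03 GEN 4 (`prover-b2b-balaban-t4-ne2-formalise-leaf-03-g4-0`); file 2∕2 of item (O8) «V-COL»,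
member UB⁺, of the P2 skeleton `t4/skeletons/NE2-t4-ne2-p2.md` v0.10 §2.E (journal INTENT CLAIMS.log l.10560).  File 1 `Support/VariationalColourUpperBound`
proves, for fields `φ : Tor M → E` in ANY normed ℂ-space `E`, site transports `T` with contractive right inverses `S` (`T∘S = 1`, `‖T‖, ‖S‖ ≤ 1`), contractive
bond transporters `R` and the IN-BLOCK defect `‖R(x,μ)∘S(x+e_μ)∘T(x) − 1‖ ≤ w` (base-point form), the k-uniform bound
`blockSpin (Qcv n M T) Sc φ ≤ 2d·36^d·((1 + n w)² + 9)·Σ‖φ‖²` (`blockSpin_colour_le`) and `exists_ubv_phys`.  THIS FILE: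
 * §1 the hypothesis phrased by blocks (`blockOf (x + e_μ) = blockOf x`; `inBlock_of_blockOf`, `blockSpin_colour_le_of_blockOf`) and the lattice-units `∃`-form
   `exists_ubv_lattice` (`Λ_lat = Λ·n^d/n²`, the shape of a REG⁺-type supplier's `hUB`);
 * §2 **ISOMETRIC SITE TRANSPORTS** `U(x) : E ≃ₗᵢ[ℂ] E` (unitary colour matrices on a finite-dimensional Hilbert space are the intended instance): `T := U`,
   `S := U⁻¹` satisfy the three transport binders (`isometry_data`), so `blockSpin_colour_le_of_isometry` displays ONLY `‖R‖ ≤ 1` and the in-block defect;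
 * §2b **UNITARY OPERATORS** on a Hilbert space `H` (`U(x) ∈ unitary (H →L[ℂ] H)`; unitary colour MATRICES through `Matrix.toEuclideanCLM`, leaf-02-g4's
   `toEuclideanCLM_mem_unitary`): `S := U⋆` (`unitary_data`), `blockSpin_colour_le_of_unitary` displays ONLY the in-block defect (bond transporters unitary too);
 * §3 **UNIT PHASES** `t • 1`, `conj t • 1` on any `E` (`phase_data`, `blockSpin_colour_le_of_phase`); at `E = ℂ` (leaf-02-g4's `phase t = t • 1`) the carriers
   ARE the scalar leaves' — `Qcv (phase t) = QT t`, `Σ_μ dirUv (phase ∘ r) = dirR r`, `nsqv = nsq` (`carriers_complex`) — so V-COL-UB at `E = ℂ` is leaf UB⁺'s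
   `blockSpin_covariant_le` (p212172) up to the spelling of (hw) (`‖R•1 ∘ conj t•1 ∘ t•1 − 1‖_op` vs `|R·conj t·t − 1|`).

HONEST FRAMING (T4-DAG p. 1).  Model level; transporters DATA (no group structure, no identification with Bałaban's `U(Γ)` — c5); [folklore]; nothing printed
is a hypothesis; no `def`, no `def … : Prop`, no `sorry`; axioms standard.  NOT CLAIMED: the unitary-MATRIX-to-`≃ₗᵢ` dictionary on `EuclideanSpace ℂ o`
(Mathlib `Matrix.toEuclideanCLM`; the consumer's one-liner once the road owner fixes the colour carrier), the other V-COL members, the 1-form leaves.  NE2 NOT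
proved; spine 0/9; rung (B)+1 finite T⁴ — NOT infinite volume, NOT mass gap, NOT Clay.  HONEST DEPENDENCY (cell, verbatim): continuum YM on T⁴ ⇐ BetaPertH ∧
nine spine estimates (0/9 proved); BetaPertH ⇐ (D1) ∧ (D4) ∧ CAP+tail; G-an2-4 gates asym, D1 and NE2/3/4.
-/

noncomputable section

namespace Summit.QuantumFields.BalabanUV.T4Continuum.VariationalColourUpperBound

open Finset
open scoped ComplexConjugate
open Literature.MathematicalPhysics.QuantumFieldTheory.Balaban1983to89
open Literature.MathematicalPhysics.QuantumFieldTheory.Balaban1983to89.B5Prop11Plancherel (Tor fine unitVec)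
open Literature.MathematicalPhysics.QuantumFieldTheory.Balaban1983to89.B5Block118 (bpt)
open Literature.MathematicalPhysics.QuantumFieldTheory.Balaban1983to89.B5Blocks16 (blockOf blockOf_bpt)
open Summit.QuantumFields.BalabanUV.T4Continuum.ScalarBlockTrialFunction (bpt_add_unitVec_of_lt)
open Summit.QuantumFields.BalabanUV.T4Continuum.VariationalTransfer (blockSpin)
open Summit.QuantumFields.BalabanUV.T4Continuum.VariationalCovariantPoincare (QT dirR)
open Summit.QuantumFields.BalabanUV.T4Continuum.VariationalColourFederbush (Qcv dirUv phase Qcv_phase dirUv_phase norm_le_one_of_mem_unitary)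
open Literature.MathematicalPhysics.QuantumFieldTheory.Balaban1983to89.B5Prop11Lower (nsq)

variable {d : ℕ} (n : ℕ) [NeZero n] (M : Fin d → ℕ) [hM : ∀ μ, NeZero (M μ)]
variable {E : Type*} [NormedAddCommGroup E] [NormedSpace ℂ E]

/-! ## §1 The block form of the in-block hypothesis; the lattice-units `∃`-form -/

/-- base-point form ⇐ block form of the in-block hypothesis: a bond `(n·y + j, n·y + j + e_μ)` with `j_μ + 1 < n` has both ends in block `y`. [folklore] -/
theorem inBlock_of_blockOf {T S : Tor (fine n M) → (E →L[ℂ] E)} {R : Tor (fine n M) → Fin d → (E →L[ℂ] E)} {w : ℝ}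
    (hw' : ∀ (x : Tor (fine n M)) (μ : Fin d), blockOf n M (x + unitVec (fine n M) μ) = blockOf n M x →
      ‖R x μ * S (x + unitVec (fine n M) μ) * T x - 1‖ ≤ w)
    (y : Tor M) (j : Fin d → Fin n) (μ : Fin d) (h : (j μ : ℕ) + 1 < n) :
    ‖R (bpt n M y j) μ * S (bpt n M y j + unitVec (fine n M) μ) * T (bpt n M y j) - 1‖ ≤ w := by
  apply hw'
  rw [bpt_add_unitVec_of_lt n M y j μ h, blockOf_bpt, blockOf_bpt]

/-- **LEAF V-COL-UB, block form of the hypothesis**: if every bond with both ends in ONE block has transport defect `‖R(x,μ)∘S(x+e_μ)∘T(x) − 1‖ ≤ w`,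
then `Δ′(φ) ≤ 2d·36^d·((1 + n·w)² + 9)·Σ‖φ‖²`. [folklore] -/
theorem blockSpin_colour_le_of_blockOf {T S : Tor (fine n M) → (E →L[ℂ] E)} (hTS : ∀ x v, T x (S x v) = v) (hT : ∀ x, ‖T x‖ ≤ 1)
    (hS : ∀ x, ‖S x‖ ≤ 1) {R : Tor (fine n M) → Fin d → (E →L[ℂ] E)} (hR : ∀ x μ, ‖R x μ‖ ≤ 1) {w : ℝ} (hw0 : 0 ≤ w)
    (hw' : ∀ (x : Tor (fine n M)) (μ : Fin d), blockOf n M (x + unitVec (fine n M) μ) = blockOf n M x →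
      ‖R x μ * S (x + unitVec (fine n M) μ) * T x - 1‖ ≤ w)
    (φ : Tor M → E) :
    blockSpin (Qcv n M T) (fun f => ((n : ℝ) ^ d)⁻¹ * ((n : ℝ) ^ 2 * ∑ μ, dirUv (fine n M) R f μ)) φ
      ≤ 2 * d * (36 : ℝ) ^ d * ((1 + n * w) ^ 2 + 9) * nsqv φ :=
  blockSpin_colour_le n M hTS hT hS hR hw0 (inBlock_of_blockOf n M hw') φ

/-- **LEAF V-COL-UB, `∃`-form, lattice units** (`Λ_lat = 2d·36^d·((1 + n w)² + 9)·n^d/n²`): `∃ f, Qcv T f = φ ∧ Σ_μ dirUv R f μ ≤ Λ_lat·Σ‖φ‖²` — the shape of the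
`hUB` binder of a REG⁺-type supplier. [folklore] -/
theorem exists_ubv_lattice {T S : Tor (fine n M) → (E →L[ℂ] E)} (hTS : ∀ x v, T x (S x v) = v) (hT : ∀ x, ‖T x‖ ≤ 1)
    (hS : ∀ x, ‖S x‖ ≤ 1) {R : Tor (fine n M) → Fin d → (E →L[ℂ] E)} (hR : ∀ x μ, ‖R x μ‖ ≤ 1) {w : ℝ} (hw0 : 0 ≤ w)
    (hw : ∀ (y : Tor M) (j : Fin d → Fin n) (μ : Fin d), (j μ : ℕ) + 1 < n →
      ‖R (bpt n M y j) μ * S (bpt n M y j + unitVec (fine n M) μ) * T (bpt n M y j) - 1‖ ≤ w) :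
    ∀ φ : Tor M → E, ∃ f : Tor (fine n M) → E, Qcv n M T f = φ ∧
      ∑ μ, dirUv (fine n M) R f μ ≤ (2 * d * (36 : ℝ) ^ d * ((1 + n * w) ^ 2 + 9) * (n : ℝ) ^ d / (n : ℝ) ^ 2) * nsqv φ := by
  intro φ
  refine ⟨_, Qcv_comp n M hTS φ, ?_⟩
  have hn2 : (0 : ℝ) < (n : ℝ) ^ 2 := by have := NeZero.ne n; positivity
  have hnd : (0 : ℝ) < (n : ℝ) ^ d := by have := NeZero.ne n; positivity
  have h := physDirv_comp_le n M hTS hT hS hR hw0 hw φ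
  rw [inv_mul_le_iff₀ hnd] at h
  rw [show (2 * d * (36 : ℝ) ^ d * ((1 + n * w) ^ 2 + 9) * (n : ℝ) ^ d / (n : ℝ) ^ 2) * nsqv φ
      = ((n : ℝ) ^ d * (2 * d * (36 : ℝ) ^ d * ((1 + n * w) ^ 2 + 9) * nsqv φ)) / (n : ℝ) ^ 2 by ring]
  rw [le_div_iff₀ hn2, mul_comm]
  exact h

/-! ## §2 Isometric site transports (unitary colour data) -/

omit [NeZero n] hM in
/-- **ISOMETRIC SITE TRANSPORTS** `U(x) : E ≃ₗᵢ[ℂ] E` (e.g. unitary colour matrices acting on a finite-dimensional Hilbert space): `T := U`, `S := U⁻¹` satisfy the three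
transport binders `T∘S = 1`, `‖T‖ ≤ 1`, `‖S‖ ≤ 1` of this file. [folklore] -/
theorem isometry_data (U : Tor (fine n M) → (E ≃ₗᵢ[ℂ] E)) :
    (∀ x v, (U x : E →L[ℂ] E) (((U x).symm : E →L[ℂ] E) v) = v) ∧ (∀ x, ‖(U x : E →L[ℂ] E)‖ ≤ 1) ∧
      (∀ x, ‖((U x).symm : E →L[ℂ] E)‖ ≤ 1) :=
  ⟨fun x v => by simp, fun x => (U x).toLinearIsometry.norm_toContinuousLinearMap_le,
    fun x => (U x).symm.toLinearIsometry.norm_toContinuousLinearMap_le⟩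

/-- **LEAF V-COL-UB FOR ISOMETRIC SITE TRANSPORTS**: with `U(x) : E ≃ₗᵢ[ℂ] E` the only remaining binders are the contractive bond transporters `‖R‖ ≤ 1` and the
IN-BLOCK defect `‖R(x,μ)∘U(x+e_μ)⁻¹∘U(x) − 1‖ ≤ w`: `Δ′(φ) ≤ 2d·36^d·((1 + n·w)² + 9)·Σ‖φ‖²`. [folklore] -/
theorem blockSpin_colour_le_of_isometry (U : Tor (fine n M) → (E ≃ₗᵢ[ℂ] E)) {R : Tor (fine n M) → Fin d → (E →L[ℂ] E)}
    (hR : ∀ x μ, ‖R x μ‖ ≤ 1) {w : ℝ} (hw0 : 0 ≤ w)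
    (hw : ∀ (y : Tor M) (j : Fin d → Fin n) (μ : Fin d), (j μ : ℕ) + 1 < n →
      ‖R (bpt n M y j) μ * ((U (bpt n M y j + unitVec (fine n M) μ)).symm : E →L[ℂ] E) * (U (bpt n M y j) : E →L[ℂ] E) - 1‖ ≤ w)
    (φ : Tor M → E) :
    blockSpin (Qcv n M (fun x => (U x : E →L[ℂ] E))) (fun f => ((n : ℝ) ^ d)⁻¹ * ((n : ℝ) ^ 2 * ∑ μ, dirUv (fine n M) R f μ)) φ
      ≤ 2 * d * (36 : ℝ) ^ d * ((1 + n * w) ^ 2 + 9) * nsqv φ := by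
  obtain ⟨hTS, hT, hS⟩ := isometry_data n M U (E := E)
  exact blockSpin_colour_le n M (T := fun x => (U x : E →L[ℂ] E)) (S := fun x => ((U x).symm : E →L[ℂ] E)) hTS hT hS hR hw0 hw φ

/-! ## §2b Unitary operators on a Hilbert space (unitary colour matrices via `Matrix.toEuclideanCLM`) -/

section Unitary

variable {H : Type*} [NormedAddCommGroup H] [InnerProductSpace ℂ H] [CompleteSpace H]

omit [NeZero n] hM in
/-- **UNITARY SITE TRANSPORTS** `U(x) ∈ unitary (H →L[ℂ] H)`: `T := U`, `S := U⋆` satisfy the three transport binders (`U∘U⋆ = 1`; norms `≤ 1` by leaf-02-g4's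
`norm_le_one_of_mem_unitary`). [folklore] -/
theorem unitary_data {U : Tor (fine n M) → (H →L[ℂ] H)} (hU : ∀ x, U x ∈ unitary (H →L[ℂ] H)) :
    (∀ x v, U x (star (U x) v) = v) ∧ (∀ x, ‖U x‖ ≤ 1) ∧ (∀ x, ‖star (U x)‖ ≤ 1) := by
  refine ⟨fun x v => ?_, fun x => norm_le_one_of_mem_unitary (hU x), fun x => norm_le_one_of_mem_unitary (Unitary.star_mem (hU x))⟩
  have h := Unitary.mul_star_self_of_mem (hU x)
  rw [← mul_apply_eq_comp, h, one_apply_eq_self]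

/-- **LEAF V-COL-UB FOR UNITARY DATA**: unitary site transports `U` and unitary bond transporters `R` on a Hilbert space `H`; the ONLY binder left is the
IN-BLOCK defect `‖R(x,μ)∘U(x+e_μ)⋆∘U(x) − 1‖ ≤ w`: `Δ′(φ) ≤ 2d·36^d·((1 + n·w)² + 9)·Σ‖φ‖²`. [folklore] -/
theorem blockSpin_colour_le_of_unitary {U : Tor (fine n M) → (H →L[ℂ] H)} (hU : ∀ x, U x ∈ unitary (H →L[ℂ] H))
    {R : Tor (fine n M) → Fin d → (H →L[ℂ] H)} (hR : ∀ x μ, R x μ ∈ unitary (H →L[ℂ] H)) {w : ℝ} (hw0 : 0 ≤ w)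
    (hw : ∀ (y : Tor M) (j : Fin d → Fin n) (μ : Fin d), (j μ : ℕ) + 1 < n →
      ‖R (bpt n M y j) μ * star (U (bpt n M y j + unitVec (fine n M) μ)) * U (bpt n M y j) - 1‖ ≤ w)
    (φ : Tor M → H) :
    blockSpin (Qcv n M U) (fun f => ((n : ℝ) ^ d)⁻¹ * ((n : ℝ) ^ 2 * ∑ μ, dirUv (fine n M) R f μ)) φ
      ≤ 2 * d * (36 : ℝ) ^ d * ((1 + n * w) ^ 2 + 9) * nsqv φ := by
  obtain ⟨hTS, hT, hS⟩ := unitary_data n M hU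
  exact blockSpin_colour_le n M (T := U) (S := fun x => star (U x)) hTS hT hS (fun x μ => norm_le_one_of_mem_unitary (hR x μ)) hw0 hw φ

end Unitary

/-! ## §3 Unit phases (the scalar leaf's data, on any `E`) -/

omit [NeZero n] hM in
/-- **UNIT PHASES** (the scalar leaf's data, acting on any `E`): `T := t • 1`, `S := conj t • 1` with `|t| = 1` satisfy the three transport binders. [folklore] -/
theorem phase_data {t : Tor (fine n M) → ℂ} (ht : ∀ x, ‖t x‖ = 1) :
    (∀ x v, (t x • (1 : E →L[ℂ] E)) ((conj (t x) • (1 : E →L[ℂ] E)) v) = v) ∧ (∀ x, ‖t x • (1 : E →L[ℂ] E)‖ ≤ 1) ∧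
      (∀ x, ‖conj (t x) • (1 : E →L[ℂ] E)‖ ≤ 1) := by
  have h1 : ‖(1 : E →L[ℂ] E)‖ ≤ 1 := ContinuousLinearMap.norm_id_le
  have h0 : 0 ≤ ‖(1 : E →L[ℂ] E)‖ := norm_nonneg _
  refine ⟨fun x v => ?_, fun x => ?_, fun x => ?_⟩
  · simp only [smul_apply, one_apply_eq_self, smul_smul]
    rw [Complex.mul_conj', ht]; simp
  · rw [norm_smul, ht x, one_mul]; exact h1
  · rw [norm_smul, Complex.norm_conj, ht x, one_mul]; exact h1

/-- **AT `E = ℂ` THE CARRIERS ARE THE SCALAR LEAF'S, LETTER FOR LETTER** (with leaf-02-g4's `phase t = t • 1`): `Qcv (phase t) f = VariationalCovariantPoincare.QT t f`,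
`Σ_μ dirUv (phase ∘ r) f μ = VariationalCovariantPoincare.dirR r f` (through `Qcv_phase`∕`dirUv_phase` and `Qc = QT`, `Σ_μ dirU = dirR` by `rfl`), `nsqv φ = nsq φ` —
so `blockSpin_colour_le_of_phase` below at `E = ℂ` IS leaf UB⁺'s `blockSpin_covariant_le` (p212172) up to the spelling of (hw). [folklore] -/
theorem carriers_complex (t : Tor (fine n M) → ℂ) (r : Tor (fine n M) → Fin d → ℂ) (f : Tor (fine n M) → ℂ) (φ : Tor M → ℂ) :
    Qcv n M (phase t) f = QT n M t f ∧ (∑ μ, dirUv (fine n M) (fun x => phase (r x)) f μ) = dirR n M r f ∧ nsqv φ = nsq φ := by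
  refine ⟨funext fun z => ?_, ?_, rfl⟩
  · rw [Qcv_phase]; rfl
  · simp only [dirUv_phase]; rfl

/-- **LEAF V-COL-UB FOR UNIT PHASES ON ANY `E`** (at `E = ℂ` the scalar leaf UB⁺'s `blockSpin_covariant_le`, up to `•` = `·`): binders `|t| = 1`, `‖R‖ ≤ 1` and the
in-block defect `‖R(x,μ)∘(conj t(x+e_μ)•1)∘(t(x)•1) − 1‖ ≤ w`. [folklore] -/
theorem blockSpin_colour_le_of_phase {t : Tor (fine n M) → ℂ} (ht : ∀ x, ‖t x‖ = 1) {R : Tor (fine n M) → Fin d → (E →L[ℂ] E)}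
    (hR : ∀ x μ, ‖R x μ‖ ≤ 1) {w : ℝ} (hw0 : 0 ≤ w)
    (hw : ∀ (y : Tor M) (j : Fin d → Fin n) (μ : Fin d), (j μ : ℕ) + 1 < n →
      ‖R (bpt n M y j) μ * (conj (t (bpt n M y j + unitVec (fine n M) μ)) • (1 : E →L[ℂ] E)) * (t (bpt n M y j) • (1 : E →L[ℂ] E)) - 1‖ ≤ w)
    (φ : Tor M → E) :
    blockSpin (Qcv n M (fun x => t x • (1 : E →L[ℂ] E))) (fun f => ((n : ℝ) ^ d)⁻¹ * ((n : ℝ) ^ 2 * ∑ μ, dirUv (fine n M) R f μ)) φ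
      ≤ 2 * d * (36 : ℝ) ^ d * ((1 + n * w) ^ 2 + 9) * nsqv φ := by
  obtain ⟨hTS, hT, hS⟩ := phase_data n M (E := E) ht
  exact blockSpin_colour_le n M (T := fun x => t x • (1 : E →L[ℂ] E)) (S := fun x => conj (t x) • (1 : E →L[ℂ] E)) hTS hT hS hR hw0 hw φ
end Summit.QuantumFields.BalabanUV.T4Continuum.VariationalColourUpperBound

end
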